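import Mathlib
import Literature.NumberTheory.Transcendental.KZIdealTetrahedron
import Literature.NumberTheory.Transcendental.SemialgebraicLineDeriv

/-!
# `OffTetraSectorKernel` (stmt-KontsevichZagierPeriods-10557) — line `odd-hyperbolic-ladder`
(skeleton v3), stub `stub_spxSemialgebraic`

In the paraboloid lift `Ql p = (|p|², p₀, p₁, 1) ∈ ℝ⁴` of a point `p = (p₀, p₁, p₂)` of the upper
half space, four rows `v : Fin 4 → Fin 4 → ℝ` span the open geodesic simplex
`Spx v = {p | 0 < p₂ ∧ ∀ a, 0 < det v · det (v with row a := Ql p)}`.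
When the entries of `v` are real algebraic, `Spx v ⊆ ℝ³` is `ℚ`-semialgebraic: each of the five
conditions is a strict inequality `0 < F(p)` for a `ℚ`-semialgebraic function `F` on `ℝ³` — the
coordinate `p₂`, respectively the product of the constant `det v` with the determinant of a matrix
whose entries are either real-algebraic constants (hence `ℚ`-definable,
`isSemialgebraicFunOn_const_of_isAlgebraic`) or the polynomial coordinates of `Ql p`
(`IsSemialgebraicFunOn.matrix_det`, Leibniz expansion); strict inequalities between semialgebraic
functions cut out semialgebraic sets (`isSemialgebraic_setOf_lt_of_isSemialgebraicFunOn`,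
graph elimination), and finite intersections of semialgebraic sets are semialgebraic.
-/

noncomputable section

open Set MvPolynomial
open Literature.ModelTheory.ExponentialFields
open Literature.NumberTheory.Transcendental

namespace Summit.KontsevichZagierPeriods.HyperbolicBloch.OffTetraSectorKernel

/-- The lifted open geodesic simplex `Spx v` of four rows with real-algebraic entries is a
`ℚ`-semialgebraic subset of `ℝ³`: five strict inequalities `0 < F(p)` with `F` `ℚ`-semialgebraic
(a coordinate, or `det v` times a determinant whose entries are real-algebraic constants or the
polynomial coordinates `|p|², p₀, p₁, 1` of the lift; real algebraic parameters are `ℚ`-definable).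
[cite: BochnakCosteRoy1998, Prop. 2.2.6] -/
theorem stub_spxSemialgebraic :
    ∀ (Ql : (Fin 3 → ℝ) → Fin 4 → ℝ), (∀ p, Ql p = ![p 0 ^ 2 + p 1 ^ 2 + p 2 ^ 2, p 0, p 1, 1]) →
    ∀ (Spx : (Fin 4 → Fin 4 → ℝ) → Set (Fin 3 → ℝ)),
      (∀ v, Spx v = {p | 0 < p 2 ∧ ∀ a, 0 < (Matrix.of v).det * ((Matrix.of v).updateRow a (Ql p)).det}) →
    ∀ (v : Fin 4 → Fin 4 → ℝ), (∀ i j, IsAlgebraic ℚ (v i j)) →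
      Literature.ModelTheory.ExponentialFields.IsSemialgebraic ℚ (Spx v) := by
  intro Ql hQl Spx hSpx v hv
  have hU : IsSemialgebraic ℚ (univ : Set (Fin 3 → ℝ)) := isSemialgebraic_univ
  -- building blocks: coordinates, the constants `0`, `1`, the squared norm
  have hc : ∀ i : Fin 3, IsSemialgebraicFunOn ℚ (univ : Set (Fin 3 → ℝ)) (fun p => p i) :=
    fun i => (isSemialgebraicFunOn_aeval hU (X i)).congr fun p _ => by simp
  have h0 : IsSemialgebraicFunOn ℚ (univ : Set (Fin 3 → ℝ)) (fun _ => (0 : ℝ)) := by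
    simpa using isSemialgebraicFunOn_natCast (k := ℚ) (R := ℝ) hU 0
  have h1 : IsSemialgebraicFunOn ℚ (univ : Set (Fin 3 → ℝ)) (fun _ => (1 : ℝ)) := by
    simpa using isSemialgebraicFunOn_natCast (k := ℚ) (R := ℝ) hU 1
  have hN : IsSemialgebraicFunOn ℚ (univ : Set (Fin 3 → ℝ))
      (fun p => p 0 ^ 2 + p 1 ^ 2 + p 2 ^ 2) :=
    (isSemialgebraicFunOn_aeval hU (X 0 ^ 2 + X 1 ^ 2 + X 2 ^ 2)).congr fun p _ => by simp
  -- the four coordinates of the lift are `ℚ`-semialgebraic functions of `p`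
  have hQ : ∀ j : Fin 4, IsSemialgebraicFunOn ℚ (univ : Set (Fin 3 → ℝ)) (fun p => Ql p j) := by
    intro j
    fin_cases j
    · exact hN.congr fun p _ => by simp [hQl]
    · exact (hc 0).congr fun p _ => by simp [hQl]
    · exact (hc 1).congr fun p _ => by simp [hQl]
    · exact h1.congr fun p _ => by simp [hQl]
  -- the entries of `v` are real-algebraic, hence `ℚ`-definable constants
  have hE : ∀ i j : Fin 4, IsSemialgebraicFunOn ℚ (univ : Set (Fin 3 → ℝ)) (fun _ => v i j) :=
    fun i j => isSemialgebraicFunOn_const_of_isAlgebraic hU (hv i j)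
  -- the constant `det v`
  have hD : IsSemialgebraicFunOn ℚ (univ : Set (Fin 3 → ℝ)) (fun _ => (Matrix.of v).det) :=
    IsSemialgebraicFunOn.matrix_det hU (M := fun _ => Matrix.of v) fun i j => hE i j
  -- the four Cramer products
  have hF : ∀ a : Fin 4, IsSemialgebraicFunOn ℚ (univ : Set (Fin 3 → ℝ))
      (fun p => (Matrix.of v).det * ((Matrix.of v).updateRow a (Ql p)).det) := by
    intro a
    refine hD.fun_mul (IsSemialgebraicFunOn.matrix_det hU fun i j => ?_)
    by_cases hi : i = a
    · subst hi
      simp only [Matrix.updateRow_self]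
      exact hQ j
    · simp only [Matrix.updateRow_ne hi, Matrix.of_apply]
      exact hE i j
  -- the five pieces
  have S0 : IsSemialgebraic ℚ {p : Fin 3 → ℝ | (0 : ℝ) < p 2} :=
    isSemialgebraic_setOf_lt_of_isSemialgebraicFunOn h0 (hc 2)
  have SF : ∀ a : Fin 4, IsSemialgebraic ℚ
      {p : Fin 3 → ℝ | (0 : ℝ) < (Matrix.of v).det * ((Matrix.of v).updateRow a (Ql p)).det} :=
    fun a => isSemialgebraic_setOf_lt_of_isSemialgebraicFunOn h0 (hF a)
  have e : Spx v = {p : Fin 3 → ℝ | (0 : ℝ) < p 2} ∩ ⋂ a ∈ (Finset.univ : Finset (Fin 4)),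
      {p : Fin 3 → ℝ | (0 : ℝ) < (Matrix.of v).det * ((Matrix.of v).updateRow a (Ql p)).det} := by
    rw [hSpx]
    ext p
    simp
  rw [e]
  exact S0.inter (IsSemialgebraic.biInter _ _ fun a _ => SF a)

end Summit.KontsevichZagierPeriods.HyperbolicBloch.OffTetraSectorKernel

end
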